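import Summits.SmoothPoincare4.SmoothPoincare4.Theses.RootDecompO

/-!
# RootDecompO — glue of the split «OneStab» of `LowComplexityExhaustion`

Proves the glue item `LowComplexityExhaustionGlue` (stmt-SmoothPoincare4-29141, support, rank 203) of
route-SmoothPoincare4-RootDecompO:
`StabOneSuffices → OneStabLowComplexity → LowComplexityExhaustion`
(stmt-SmoothPoincare4-29139 → 29140 → 28545).

Pure logic: a homotopy 4-sphere `M` (compact by `compactSpace_of_homotopyEquiv_sphere_four_holds`, orientable by
`isOrientable_of_homotopyEquiv_sphere_four_holds` — both PROVED tree theorems) is bundled as a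
`Literature.Topology.FourManifolds.HomotopySphere 4` exactly as in the route's `closes`; `StabOneSuffices` supplies the
one stabilisation `M # S²×S² ≅ S²×S²` and `OneStabLowComplexity` turns it into the three-way disjunction of the parent.
Root decomposition cell decomp-sp4 (D-0178), LANDING LIST 2 (writer g6); 0 sorry. Nothing here proves `SmoothPoincare4`.
-/

set_option linter.dupNamespace false

namespace Summit.SmoothPoincare4.SmoothPoincare4.Theorems.RootDecompOLowComplexityExhaustionSplit

open Summit.SmoothPoincare4.SmoothPoincare4.Theses.RootDecompO

/-- Item stmt-SmoothPoincare4-29141: one stabilisation + its low-complexity trichotomy re-assemble the parent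
`LowComplexityExhaustion`. -/
theorem lowComplexityExhaustionGlue_holds : LowComplexityExhaustionGlue := by
  intro hS hB M _ _ _ _ _ e
  haveI : CompactSpace M :=
    Literature.Topology.FourManifolds.compactSpace_of_homotopyEquiv_sphere_four_holds M e
  obtain ⟨o⟩ :=
    Literature.Topology.FourManifolds.isOrientable_of_homotopyEquiv_sphere_four_holds M e
  exact hB ⟨M, o, ⟨e⟩⟩ (hS ⟨M, o, ⟨e⟩⟩)

end Summit.SmoothPoincare4.SmoothPoincare4.Theorems.RootDecompOLowComplexityExhaustionSplit
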